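import Literature.MathematicalPhysics.QuantumFieldTheory.CubicalCochainsBox
import HarnessLib

/-!
# The Poincaré lemma in degree two on a box of `ℤ^d` (cone primitive)

Support file for the Kramers–Wannier / Wegner self-duality of four-dimensional `ℤ₂` lattice gauge
theory on the torus (`Summit.QuantumFields.YangMills.Theses.ModularSelfDualFold.Z2TorusFreeEnergySelfDuality`).
Companion of the tree's `CubicalCochainsBox` (degree one: flat ⇒ pure gauge on a box) in degree
two: an alternating `2`-cochain `ω` on `ℤ^d` which is **closed on a box** `[a, b]` — no flux out
of any `3`-cell of the box — agrees on every plaquette of the box with the coboundary `d₁ θ` of an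
explicit `1`-cochain `θ = conePrim ω a`, the lattice cone (homotopy) operator from the corner `a`:
`θ(x; j) = ∑_{n < j} ∑_{a_n ≤ s < x_n} ω((a_0,…,a_{n-1}, s, x_{n+1},…); n, j)`.
No support hypothesis is needed (contrast with the compactly supported Poincaré lemma
`LatticeForm.exists_d₁_eq_of_d₂_eq_zero_of_three_le` of `CubicalCochains`). Everything here is
proved; it is pure lattice exterior calculus (Forsström–Lenells–Viklund 2022, §2, Lemma 2.2).

## Main result

* `exists_d₁_eq_on_box`: closed on the box ⇒ exact on the box.
-/

namespace Summit.QuantumFields.YangMills.Theorems.Z2SelfDuality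

open Finset Function
open Literature.Probability.LatticeModels (Site)
open Literature.MathematicalPhysics.QuantumFieldTheory.LatticeForm

variable {d : ℕ} {A : Type*} [AddCommGroup A]

/-! ### Freezing the low coordinates at the corner -/

/-- `frz a n y`: the point `y` with its coordinates of index `< n` reset to those of the corner
`a`. [folklore] -/
def frz (a : Site d) (n : ℕ) (y : Site d) : Site d := fun m => if m.val < n then a m else y m

/-- Coordinates below `n` are frozen. [folklore] -/
theorem frz_apply_of_lt (a : Site d) {n : ℕ} (y : Site d) {m : Fin d} (hm : m.val < n) :
    frz a n y m = a m := by simp [frz, hm]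

/-- Coordinates from `n` on are free. [folklore] -/
theorem frz_apply_of_le (a : Site d) {n : ℕ} (y : Site d) {m : Fin d} (hm : n ≤ m.val) :
    frz a n y m = y m := by simp [frz, not_lt.2 hm]

/-- Nothing is frozen at stage `0`. [folklore] -/
@[simp] theorem frz_zero (a y : Site d) : frz a 0 y = y := by
  funext m; simp [frz]

/-- Freezing commutes with a translation in a free direction. [folklore] -/
theorem frz_add_single_of_le (a : Site d) {n : ℕ} {i : Fin d} (hi : n ≤ i.val) (y : Site d) (c : ℤ) :
    frz a n (y + Pi.single i c) = frz a n y + Pi.single i c := by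
  funext m
  by_cases hm : m.val < n
  · have hmi : m ≠ i := fun h => by subst h; omega
    simp [frz, hm, Pi.single_eq_of_ne hmi]
  · simp [frz, hm]

/-- Freezing absorbs a translation in a frozen direction. [folklore] -/
theorem frz_add_single_of_lt (a : Site d) {n : ℕ} {i : Fin d} (hi : i.val < n) (y : Site d) (c : ℤ) :
    frz a n (y + Pi.single i c) = frz a n y := by
  funext m
  by_cases hm : m.val < n
  · simp [frz, hm]
  · have hmi : m ≠ i := fun h => by subst h; omega
    simp [frz, hm, Pi.single_eq_of_ne hmi]

/-- Freezing commutes with updating a free coordinate. [folklore] -/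
theorem frz_update_of_le (a : Site d) {n : ℕ} {i : Fin d} (hi : n ≤ i.val) (y : Site d) (t : ℤ) :
    frz a n (update y i t) = update (frz a n y) i t := by
  funext m
  by_cases hmi : m = i
  · subst hmi; simp [frz, not_lt.2 hi]
  · simp [frz, update_of_ne hmi]

/-- One more frozen coordinate: `frz a (n+1) y = frz a n (y with y_n := a_n)`. [folklore] -/
theorem frz_succ (a : Site d) {n : ℕ} (hn : n < d) (y : Site d) :
    frz a (n + 1) y = frz a n (update y ⟨n, hn⟩ (a ⟨n, hn⟩)) := by
  funext m
  by_cases hm : m.val < n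
  · have hmn : m ≠ ⟨n, hn⟩ := fun h => by subst h; simp at hm
    simp [frz, hm, show m.val < n + 1 by omega]
  · by_cases hmn : m = ⟨n, hn⟩
    · subst hmn; simp [frz]
    · have hmv : m.val ≠ n := fun h => hmn (Fin.ext h)
      simp [frz, hm, show ¬ m.val < n + 1 by omega, update_of_ne hmn]

/-- A frozen point of the box stays in the box. [folklore] -/
theorem frz_mem_Icc {a b x : Site d} (hx : x ∈ Set.Icc a b) (n : ℕ) : frz a n x ∈ Set.Icc a b := by
  refine ⟨fun m => ?_, fun m => ?_⟩
  · by_cases hm : m.val < n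
    · simp [frz, hm]
    · simp only [frz, hm, if_false]; exact hx.1 m
  · by_cases hm : m.val < n
    · simp only [frz, hm, if_true]; exact (hx.1 m).trans (hx.2 m)
    · simp only [frz, hm, if_false]; exact hx.2 m

/-! ### The cone primitive -/

/-- The piece of the cone primitive integrating along the axis `n` (zero for `n ≥ d`):
`conePiece ω a n j x = ∑_{a_n ≤ s < x_n} ω((a_{<n}, s, x_{>n}); n, j)`. [folklore] -/
def conePiece (ω : Site d → Fin d → Fin d → A) (a : Site d) (n : ℕ) (j : Fin d) (x : Site d) : A :=
  if h : n < d then axisPrim (fun y => ω (frz a n y) ⟨n, h⟩ j) ⟨n, h⟩ (a ⟨n, h⟩) x else 0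

/-- **The cone primitive** (lattice homotopy operator from the corner `a`):
`conePrim ω a x j = ∑_{n < j} conePiece ω a n j x`. [folklore] -/
def conePrim (ω : Site d → Fin d → Fin d → A) (a : Site d) : Site d → Fin d → A :=
  fun x j => ∑ n ∈ Finset.range j.val, conePiece ω a n j x

variable (ω : Site d → Fin d → Fin d → A) (a : Site d)

/-- The piece along a genuine axis `n < d`. [folklore] -/
theorem conePiece_of_lt {n : ℕ} (h : n < d) (j : Fin d) (x : Site d) :
    conePiece ω a n j x = axisPrim (fun y => ω (frz a n y) ⟨n, h⟩ j) ⟨n, h⟩ (a ⟨n, h⟩) x := by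
  simp [conePiece, h]

/-- The piece along the axis of a direction `i : Fin d`. [folklore] -/
theorem conePiece_val (i j : Fin d) (x : Site d) :
    conePiece ω a i.val j x = axisPrim (fun y => ω (frz a i.val y) i j) i (a i) x := by
  simp [conePiece, i.2]

/-- A piece integrating along a frozen-later axis `n > i` does not see a translation by `eᵢ`.
[folklore] -/
theorem conePiece_add_e_of_lt {n : ℕ} {i : Fin d} (hi : i.val < n) (j : Fin d) (x : Site d) :
    conePiece ω a n j (x + e i) = conePiece ω a n j x := by
  by_cases h : n < d
  · have hne : i ≠ ⟨n, h⟩ := fun h' => by subst h'; simp at hi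
    rw [conePiece_of_lt ω a h, conePiece_of_lt ω a h]
    unfold axisPrim
    rw [add_single_apply_of_ne x (Ne.symm hne), axisSum_add_single_of_ne _ hne]
    simp only [frz_add_single_of_lt a hi]
  · simp [conePiece, h]

/-- The piece along the axis `i` itself telescopes to the integrand (for `a_i ≤ x_i`). [folklore] -/
theorem conePiece_add_e_self_sub (i j : Fin d) {x : Site d} (hx : a i ≤ x i) :
    conePiece ω a i.val j (x + e i) - conePiece ω a i.val j x = ω (frz a i.val x) i j := by
  rw [conePiece_val, conePiece_val]
  exact axisPrim_add_single_sub_of_le (fun y => ω (frz a i.val y) i j) i (a i) hx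

/-- A piece integrating along an earlier axis `n < i` changes, under translation by `eᵢ`, by the
sum of the transverse differences of the integrand. [folklore] -/
theorem conePiece_add_e_of_gt_sub {n : ℕ} (hn : n < d) {i : Fin d} (hi : n < i.val) (j : Fin d)
    (x : Site d) :
    conePiece ω a n j (x + e i) - conePiece ω a n j x =
      ∑ s ∈ Finset.range (x ⟨n, hn⟩ - a ⟨n, hn⟩).toNat,
        (ω (frz a n (update x ⟨n, hn⟩ (a ⟨n, hn⟩ + s)) + e i) ⟨n, hn⟩ j -
          ω (frz a n (update x ⟨n, hn⟩ (a ⟨n, hn⟩ + s))) ⟨n, hn⟩ j) := by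
  have hne : i ≠ ⟨n, hn⟩ := fun h' => by subst h'; simp at hi
  rw [conePiece_of_lt ω a hn, conePiece_of_lt ω a hn]
  unfold axisPrim
  rw [add_single_apply_of_ne x (Ne.symm hne), axisSum_add_single_of_ne _ hne]
  simp only [axisSum, frz_add_single_of_le a hi.le]
  rw [← Finset.sum_sub_distrib]

/-- The cone primitive in direction `j`, translated by `eᵢ` with `i < j`: the pieces `n < i`
contribute transverse differences, the piece `n = i` the integrand, the pieces `i < n < j`
nothing. [folklore] -/
theorem conePrim_add_e_sub_of_lt {i j : Fin d} (hij : i < j) {x : Site d} (hx : a i ≤ x i) :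
    conePrim ω a (x + e i) j - conePrim ω a x j =
      ω (frz a i.val x) i j +
        ∑ n ∈ Finset.range i.val, (conePiece ω a n j (x + e i) - conePiece ω a n j x) := by
  unfold conePrim
  rw [← Finset.sum_sub_distrib]
  have hij' : i.val < j.val := hij
  have hsplit : Finset.range j.val = Finset.range (i.val + 1) ∪ Finset.Ico (i.val + 1) j.val := by
    rw [Finset.range_eq_Ico, Finset.range_eq_Ico, Finset.Ico_union_Ico_eq_Ico (by omega) (by omega)]
  rw [hsplit, Finset.sum_union (by
    rw [Finset.range_eq_Ico]; exact Finset.Ico_disjoint_Ico_consecutive _ _ _)]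
  have hzero : ∑ n ∈ Finset.Ico (i.val + 1) j.val,
      (conePiece ω a n j (x + e i) - conePiece ω a n j x) = 0 := by
    refine Finset.sum_eq_zero fun n hn => ?_
    rw [conePiece_add_e_of_lt ω a (by have := (Finset.mem_Ico.1 hn).1; omega), sub_self]
  rw [hzero, add_zero, Finset.sum_range_succ, conePiece_add_e_self_sub ω a i j hx, add_comm]

/-- The cone primitive in direction `i`, translated by `eⱼ` with `i < j`: only transverse
differences of the pieces `n < i`. [folklore] -/
theorem conePrim_add_e_sub_of_gt (i j : Fin d) (x : Site d) :
    conePrim ω a (x + e j) i - conePrim ω a x i =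
      ∑ n ∈ Finset.range i.val, (conePiece ω a n i (x + e j) - conePiece ω a n i x) := by
  unfold conePrim
  rw [← Finset.sum_sub_distrib]

/-- **The cone primitive is a primitive on the box.** For an alternating `2`-cochain `ω` closed on
the box `[a, b]` (`d₂ ω (z; n, i, j) = 0` for sorted `n < i < j` whenever `z` and
`z + e_n + eᵢ + eⱼ` lie in the box) and a plaquette `(x; i < j)` of the box,
`d₁ (conePrim ω a) (x; i, j) = ω (x; i, j)`. [cite: ForsstromLenellsViklund2022, §2 (Lemma 2.2, the Poincaré lemma)] -/
theorem d₁_conePrim_of_lt {b : Site d}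
    (hcl : ∀ (z : Site d) (n i j : Fin d), n < i → i < j → z ∈ Set.Icc a b →
      z + e n + e i + e j ∈ Set.Icc a b → d₂ ω z n i j = 0)
    {x : Site d} {i j : Fin d} (hij : i < j) (hx : x ∈ Set.Icc a b)
    (hxij : x + e i + e j ∈ Set.Icc a b) :
    d₁ (conePrim ω a) x i j = ω x i j := by
  have hai : a i ≤ x i := hx.1 i
  have hd₁ : d₁ (conePrim ω a) x i j =
      (conePrim ω a (x + e i) j - conePrim ω a x j) - (conePrim ω a (x + e j) i - conePrim ω a x i) := by
    simp only [d₁]; abel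
  rw [hd₁, conePrim_add_e_sub_of_lt ω a hij hai, conePrim_add_e_sub_of_gt ω a i j,
    add_sub_assoc, ← Finset.sum_sub_distrib]
  -- the inner sums telescope by closedness
  have hinner : ∀ n ∈ Finset.range i.val,
      (conePiece ω a n j (x + e i) - conePiece ω a n j x) -
        (conePiece ω a n i (x + e j) - conePiece ω a n i x) =
        ω (frz a n x) i j - ω (frz a (n + 1) x) i j := by
    intro n hn
    have hni : n < i.val := Finset.mem_range.1 hn
    have hnd : n < d := lt_trans hni i.2
    set κ : Fin d := ⟨n, hnd⟩ with hκ
    have hκi : κ < i := Fin.lt_def.2 (by simpa [hκ] using hni)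
    rw [conePiece_add_e_of_gt_sub ω a hnd hni, conePiece_add_e_of_gt_sub ω a hnd (hni.trans hij),
      ← Finset.sum_sub_distrib]
    -- closedness on the cubes `(z_s; κ, i, j)`
    set N := (x κ - a κ).toNat with hN
    have haκ : a κ ≤ x κ := hx.1 κ
    have hz : ∀ s : ℕ, frz a n (update x κ (a κ + s)) + e κ = frz a n (update x κ (a κ + (s + 1 : ℕ))) := by
      intro s
      rw [← frz_add_single_of_le a (le_refl κ.val), update_add_single_eq]
      push_cast; rw [add_assoc]
    have hstep : ∀ s ∈ Finset.range N,
        (ω (frz a n (update x κ (a κ + s)) + e i) κ j - ω (frz a n (update x κ (a κ + s))) κ j) -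
          (ω (frz a n (update x κ (a κ + s)) + e j) κ i - ω (frz a n (update x κ (a κ + s))) κ i) =
          ω (frz a n (update x κ (a κ + (s + 1 : ℕ)))) i j - ω (frz a n (update x κ (a κ + s))) i j := by
      intro s hs
      have hs' : s < N := Finset.mem_range.1 hs
      set z := frz a n (update x κ (a κ + s)) with hzdef
      -- `z` and `z + eκ + eᵢ + eⱼ` are in the box
      have hsN : (s : ℤ) < x κ - a κ := by
        have h1 : s < (x κ - a κ).toNat := hN ▸ hs'
        omega
      have hbκ : x κ ≤ b κ := hx.2 κ
      have hzmem : z ∈ Set.Icc a b := by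
        rw [hzdef, frz_update_of_le a (le_refl κ.val)]
        exact update_mem_Icc_of_mem (frz_mem_Icc hx n) κ ⟨by omega, by omega⟩
      have hzmem' : z + e κ + e i + e j ∈ Set.Icc a b := by
        rw [hzdef, hz s, frz_update_of_le a (le_refl κ.val),
          ← update_add_single_of_ne _ (ne_of_lt hκi).symm,
          ← update_add_single_of_ne _ (ne_of_lt (hκi.trans hij)).symm,
          ← frz_add_single_of_le a hκi.le, ← frz_add_single_of_le a (hκi.trans hij).le]
        exact update_mem_Icc_of_mem (frz_mem_Icc hxij n) κ ⟨by push_cast; omega, by push_cast; omega⟩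
      have hc := hcl z κ i j hκi hij hzmem hzmem'
      simp only [d₂] at hc
      rw [← hz s]
      -- `hc : (ω (z+eκ) i j - ω z i j) - (ω (z+eᵢ) κ j - ω z κ j) + (ω (z+eⱼ) κ i - ω z κ i) = 0`
      have : (ω (z + e i) κ j - ω z κ j) - (ω (z + e j) κ i - ω z κ i) - (ω (z + e κ) i j - ω z i j) =
          -((ω (z + e κ) i j - ω z i j) - (ω (z + e i) κ j - ω z κ j) + (ω (z + e j) κ i - ω z κ i)) := by
        abel
      rw [hc, neg_zero] at this
      exact sub_eq_zero.1 this
    rw [Finset.sum_congr rfl hstep,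
      Finset.sum_range_sub (f := fun s : ℕ => ω (frz a n (update x κ (a κ + s))) i j)]
    have hNc : a κ + ((N : ℕ) : ℤ) = x κ := by omega
    simp only [Nat.cast_zero, add_zero, hNc, update_eq_self]
    rw [frz_succ a hnd]
  rw [Finset.sum_congr rfl hinner,
    Finset.sum_range_sub' (f := fun n : ℕ => ω (frz a n x) i j), frz_zero]
  abel

/-- **Poincaré lemma in degree two on a box of `ℤ^d`** (closed ⇒ exact on the box, no support
hypothesis). Let `ω` be an alternating `2`-cochain which is closed on the box `[a, b]`: for all
sorted directions `n < i < j` and every `z` with `z` and `z + e_n + eᵢ + eⱼ` in the box,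
`d₂ ω (z; n, i, j) = 0`. Then there is a `1`-cochain `θ` (the cone primitive `conePrim ω a`) with
`d₁ θ (x; i, j) = ω (x; i, j)` for every plaquette of the box (`x` and `x + eᵢ + eⱼ` in `[a, b]`).
In gauge-theory language: on a box every Bianchi-closed plaquette field is the plaquette field of
some link field. [cite: ForsstromLenellsViklund2022, §2 (Lemma 2.2, the Poincaré lemma)] -/
theorem exists_d₁_eq_on_box (ω : Site d → Fin d → Fin d → A) (a b : Site d)
    (halt : ∀ x i j, ω x j i = -ω x i j) (hdiag : ∀ x i, ω x i i = 0)
    (hcl : ∀ (z : Site d) (n i j : Fin d), n < i → i < j → z ∈ Set.Icc a b →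
      z + e n + e i + e j ∈ Set.Icc a b → d₂ ω z n i j = 0) :
    ∃ θ : Site d → Fin d → A, ∀ (x : Site d) (i j : Fin d), x ∈ Set.Icc a b →
      x + e i + e j ∈ Set.Icc a b → d₁ θ x i j = ω x i j := by
  refine ⟨conePrim ω a, fun x i j hx hxij => ?_⟩
  rcases lt_trichotomy i j with hij | rfl | hij
  · exact d₁_conePrim_of_lt ω a hcl hij hx hxij
  · rw [d₁_self, hdiag]
  · rw [d₁_swap, halt, d₁_conePrim_of_lt ω a hcl hij hx (by rwa [add_right_comm] at hxij)]

end Summit.QuantumFields.YangMills.Theorems.Z2SelfDuality
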